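import Literature.Analysis.FluidPDE.PressureNormalisationL3
import HarnessLib

/-!
# The harmonic part of the pressure of a classical solution, for an arbitrary weak pressure

Analysis/FluidPDE proofs file (theorems only), on the discharge path of
`Literature.Analysis.FluidPDE.chaeWolf2017_dss_typeI_decay` (Chae–Wolf 2017, Thm. 1.1, whose
solutions are classical with slices in `C((−∞,0); L^q)`, `3 ≤ q < ∞`, and an *a priori arbitrary*
smooth pressure; the Calderón–Zygmund step "(2.4b) `‖π(t)‖_{q/2} ≤ C‖u(t)‖²_q`" of its proof,
arXiv p. 5, presupposes that the pressure IS the Riesz pressure `RᵢRⱼ(uᵢuⱼ)`, which is what the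
normalisation lemma supplies). This is the first half of the `L^q` version of Tao's
pressure-normalisation lemma (Tao 2011 = arXiv:1108.1165, Lemma 4.1 (i)); the `L³` version is the
accepted `PressureHarmonicPartL3.lean` / `PressureNormalisationL3.lean`, whose slice pressure is
the tree's operator `rieszPressure : L³ → L^{3/2}`. For `q > 3` the slices are not in `L³`, and the
tree's Calderón–Zygmund pressure at exponent `q/2` is the *existence* statement
`exists_rieszPressure` (`NecasRuzickaSverakRiesz.lean`: some `Q ∈ L^{q/2}` with
`∫ Q Δφ = −∫ D²φ(u, u)`), so this file is written for an **arbitrary** locally integrable `Q`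
solving the weak pressure Poisson equation of the slice `u(t)`:

* `integral_harmonicPart_mul_laplacian` — `g(t) = p(t) − Q` is harmonic in the sense of
  distributions (pressure Poisson equation `Δp = −∂ᵢ∂ⱼ(uᵢuⱼ)` of the classical solution against
  the weak Poisson equation of `Q`);
* `harmonicOnNhd_mollified_harmonicPart` — every mollification `θ ⋆ g(t)` is harmonic on `ℝ³`;
* `fderiv_mollified_harmonicPart_eq` — **the probe identity** (Tao's computation of
  `∫∫ ∇h χ_R`): for `R > 0`, `x₀`, `a`, with `Φ = χ_R ⋆ θ` the combined test function of
  `PressureHarmonicPartL3.lean`,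
  `∂ₐ(θ ⋆ g(t))(x₀) = ν∫⟪u, ΔΨ⟫ + ∫⟪u, (u·∇)Ψ⟫ − ∫⟪∂ₜu, Ψ⟫ − ∫ ∂ₐΦ(y) Q(x₀ − y) dy`,
  `Ψ(y) = Φ(x₀ − y) a` — literally the proof of
  `PressureNormalisationL3.fderiv_mollified_harmonicPart_eq` with `Q` for `Π[u(t)]`.

The bounds of the four terms in `L^q × L^{q/2}` and the conclusion `p(t) = Q + C(t)` a.e. are in
`PressureNormalisationLq.lean`.

## References

* T. Tao, *Localisation and compactness properties of the Navier–Stokes global regularity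
  problem*, Anal. PDE 6 (2013) 25–107 = arXiv:1108.1165, §4, Lemma 4.1 (i) and its proof.
  [Tao2011]
* D. Chae, J. Wolf, Comm. PDE 42 (2017) = arXiv:1610.09464, §2, (2.4b) (arXiv p. 5).
  [ChaeWolf2017RemovingDSS]
-/

noncomputable section

open MeasureTheory Set Filter Metric Function ContinuousLinearMap
open scoped Topology Laplacian ContDiff Convolution InnerProductSpace RealInnerProductSpace ENNReal

namespace Literature.Analysis.FluidPDE

namespace PressureNormalisation

open PressureNormalisationL3

variable {S : Set ℝ} {ν : ℝ} {u : ℝ → (EuclideanSpace ℝ (Fin 3)) → (EuclideanSpace ℝ (Fin 3))}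
  {p : ℝ → (EuclideanSpace ℝ (Fin 3)) → ℝ} {Q : (EuclideanSpace ℝ (Fin 3)) → ℝ}

/-! ### The harmonic part `g(t) = p(t) − Q` -/

/-- The harmonic part `p(t) − Q` is locally integrable (continuous minus locally integrable). [folklore] -/
theorem locallyIntegrable_harmonicPart (h : IsClassicalNSSolutionOn S ν 0 u p) {t : ℝ}
    (ht : t ∈ S) (hQ : LocallyIntegrable Q volume) :
    LocallyIntegrable (fun x => p t x - Q x) volume :=
  (h.contDiff_pressure ht).continuous.locallyIntegrable.sub hQ

/-- **The harmonic part is harmonic in the sense of distributions**: for a classical solution of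
the unforced system on an open time set `S`, `t ∈ S`, a locally integrable `Q` solving the weak
pressure Poisson equation of the slice, `∫ Q Δφ = −∫ D²φ(u(t), u(t))`, and every smooth compactly
supported `ψ`, `∫ (p(t) − Q) Δψ = 0` (the classical pressure solves `Δp = −∂ᵢ∂ⱼ(uᵢuⱼ)`,
Tao 2011 (8)). [cite: Tao2011, §4, proof of Lemma 4.1 (i)] -/
theorem integral_harmonicPart_mul_laplacian (h : IsClassicalNSSolutionOn S ν 0 u p)
    (hS : IsOpen S) {t : ℝ} (ht : t ∈ S) (hQ : LocallyIntegrable Q volume)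
    (hQeq : ∀ φ : (EuclideanSpace ℝ (Fin 3)) → ℝ, ContDiff ℝ ∞ φ → HasCompactSupport φ →
      ∫ y, Q y * (Δ φ) y = -∫ y, fderiv ℝ (fderiv ℝ φ) y (u t y) (u t y))
    {ψ : (EuclideanSpace ℝ (Fin 3)) → ℝ} (hψ : ContDiff ℝ ∞ ψ) (hψc : HasCompactSupport ψ) :
    ∫ x, (p t x - Q x) * (Δ ψ) x = 0 := by
  have hti : t ∈ interior S := by rwa [hS.interior_eq]
  have hu : ContDiff ℝ ∞ (u t) := h.contDiff_velocity ht
  have hp : ContDiff ℝ ∞ (p t) := h.contDiff_pressure ht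
  have hu2 : ContDiff ℝ 2 (u t) := contDiff_infty.1 hu 2
  have hp2 : ContDiff ℝ 2 (p t) := contDiff_infty.1 hp 2
  have hψ2 : ContDiff ℝ 2 ψ := contDiff_infty.1 hψ 2
  have hΔψc : Continuous (Δ ψ) := FluidPDE.continuous_laplacian hψ2
  have hΔψs : HasCompactSupport (Δ ψ) := hψc.mono' fun x hx => by
    contrapose! hx
    simp [FluidPDE.laplacian_eq_zero_of_notMem_tsupport hx]
  -- the pressure Poisson equation `Δ p = -G[u]`
  have hPoisson : ∀ x, (Δ (p t)) x = -pressureSource (u t) x := fun x => by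
    rw [laplacian_pressure_eq_of_isClassicalNSSolutionOn h hti x,
      pressureSource_eq_of_isDivFree (h.divFree t ht)]
    have : VectorCalculus.divergence ((0 : ℝ → (EuclideanSpace ℝ (Fin 3)) → (EuclideanSpace ℝ (Fin 3))) t) x = 0 := by
      simp [VectorCalculus.divergence]
    rw [this, add_zero]
  -- `∫ p Δψ = ∫ ψ Δp = -∫ ψ G[u] = -∫ D²ψ(u, u)`
  have h1 : ∫ x, p t x * (Δ ψ) x = -∫ x, fderiv ℝ (fderiv ℝ ψ) x (u t x) (u t x) := by
    have e1 : ∫ x, p t x * (Δ ψ) x = ∫ x, (Δ ψ) x * p t x :=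
      integral_congr_ae (Eventually.of_forall fun x => mul_comm _ _)
    rw [e1, ← integral_mul_laplacian_comm hp2 hψ2 hψc, ← integral_mul_pressureSource hψ2 hψc hu2,
      ← integral_neg]
    refine integral_congr_ae (Eventually.of_forall fun x => ?_)
    show ψ x * (Δ (p t)) x = -(ψ x * pressureSource (u t) x)
    rw [hPoisson x]
    ring
  -- `∫ Q Δψ = -∫ D²ψ(u, u)`
  have h2 : ∫ x, Q x * (Δ ψ) x = -∫ x, fderiv ℝ (fderiv ℝ ψ) x (u t x) (u t x) := hQeq ψ hψ hψc
  -- integrability, to split the difference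
  have i1 : Integrable fun x => p t x * (Δ ψ) x :=
    (hp.continuous.mul hΔψc).integrable_of_hasCompactSupport hΔψs.mul_left
  have i2 : Integrable fun x => Q x * (Δ ψ) x := by
    have hK : IsCompact (tsupport (Δ ψ)) := hΔψs
    have hon : IntegrableOn (fun x => Q x * (Δ ψ) x) (tsupport (Δ ψ)) :=
      (hQ.integrableOn_isCompact hK).mul_continuousOn hΔψc.continuousOn hK
    exact (integrableOn_iff_integrable_of_support_subset
      ((support_mul_subset_right _ _).trans (subset_tsupport _))).1 hon
  have e : ∫ x, (p t x - Q x) * (Δ ψ) x = ∫ x, (p t x * (Δ ψ) x - Q x * (Δ ψ) x) :=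
    integral_congr_ae (Eventually.of_forall fun x => sub_mul _ _ _)
  rw [e, integral_sub i1 i2, h1, h2, sub_self]

/-- **Every mollification of the harmonic part is harmonic on `ℝ³`** (`θ` smooth with compact
support). [cite: Tao2011, §4, proof of Lemma 4.1 (i)] -/
theorem harmonicOnNhd_mollified_harmonicPart (h : IsClassicalNSSolutionOn S ν 0 u p)
    (hS : IsOpen S) {t : ℝ} (ht : t ∈ S) (hQ : LocallyIntegrable Q volume)
    (hQeq : ∀ φ : (EuclideanSpace ℝ (Fin 3)) → ℝ, ContDiff ℝ ∞ φ → HasCompactSupport φ →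
      ∫ y, Q y * (Δ φ) y = -∫ y, fderiv ℝ (fderiv ℝ φ) y (u t y) (u t y))
    {θ : (EuclideanSpace ℝ (Fin 3)) → ℝ} (hθ : ContDiff ℝ ∞ θ) (hθc : HasCompactSupport θ) :
    InnerProductSpace.HarmonicOnNhd (θ ⋆ fun x => p t x - Q x) univ :=
  ConvolutionLaplacian.harmonicOnNhd_convolution (locallyIntegrable_harmonicPart h ht hQ)
    (fun _ hψ hψc => integral_harmonicPart_mul_laplacian h hS ht hQ hQeq hψ hψc) hθ hθc

/-! ### The probe identity for the mollified harmonic part -/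

/-- **The probe identity** (Tao 2011, §4, proof of Lemma 4.1 (i), the computation of
`∫∫ ∇h χ_R`, for the mollified harmonic part). Let `(u, p)` be a classical solution of the
unforced system on an open time set `S`, `t ∈ S`, `Q` a locally integrable solution of the weak
pressure Poisson equation of the slice `u(t)`, `θ = φ.normed` a normed bump, `R > 0`, and
`Φ = χ_R ⋆ θ`. Then for every centre `x₀` and direction `a`
`∂ₐ(θ ⋆ (p(t) − Q))(x₀) = ν ∫⟪u, ΔΨ⟫ + ∫⟪u, (u·∇)Ψ⟫ − ∫⟪∂ₜu, Ψ⟫ − ∫ ∂ₐΦ(y) Q(x₀ − y) dy`,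
`Ψ(y) = Φ(x₀ − y) a`. [cite: Tao2011, §4, proof of Lemma 4.1 (i)] -/
theorem fderiv_mollified_harmonicPart_eq (h : IsClassicalNSSolutionOn S ν 0 u p) (hS : IsOpen S)
    {t : ℝ} (ht : t ∈ S) (hQ : LocallyIntegrable Q volume)
    (hQeq : ∀ φ : (EuclideanSpace ℝ (Fin 3)) → ℝ, ContDiff ℝ ∞ φ → HasCompactSupport φ →
      ∫ y, Q y * (Δ φ) y = -∫ y, fderiv ℝ (fderiv ℝ φ) y (u t y) (u t y))
    (φ : ContDiffBump (0 : (EuclideanSpace ℝ (Fin 3)))) {R : ℝ}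
    (hR : 0 < R) (x₀ a : (EuclideanSpace ℝ (Fin 3))) :
    fderiv ℝ (φ.normed volume ⋆ fun x => p t x - Q x) x₀ a =
      ν * (∫ y, ⟪u t y, (Δ (fun y => (probeBump R ⋆ φ.normed volume) (x₀ - y))) y • a⟫)
      + (∫ y, ⟪u t y,
          fderiv ℝ (fun y => (probeBump R ⋆ φ.normed volume) (x₀ - y)) y (u t y) • a⟫)
      - (∫ y, ⟪FluidPDE.timeDerivWithin S u t y, (probeBump R ⋆ φ.normed volume) (x₀ - y) • a⟫)
      - ∫ y, fderiv ℝ (probeBump R ⋆ φ.normed volume) y a * Q (x₀ - y) := by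
  haveI : CompleteSpace (EuclideanSpace ℝ (Fin 3)) := inferInstance
  -- names
  set g : (EuclideanSpace ℝ (Fin 3)) → ℝ := fun x => p t x - Q x with hg_def
  set θ : (EuclideanSpace ℝ (Fin 3)) → ℝ := φ.normed volume with hθ_def
  set χ : (EuclideanSpace ℝ (Fin 3)) → ℝ := probeBump R with hχ_def
  set Φ : (EuclideanSpace ℝ (Fin 3)) → ℝ := χ ⋆ θ with hΦ_def
  -- regularity of the data
  have hu : ContDiff ℝ ∞ (u t) := h.contDiff_velocity ht
  have hp : ContDiff ℝ ∞ (p t) := h.contDiff_pressure ht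
  have hu2 : ContDiff ℝ 2 (u t) := contDiff_infty.1 hu 2
  have hu1 : ContDiff ℝ 1 (u t) := contDiff_infty.1 hu 1
  have hp1 : ContDiff ℝ 1 (p t) := contDiff_infty.1 hp 1
  have huc : Continuous (u t) := hu.continuous
  have hPiloc : LocallyIntegrable Q volume := hQ
  have hgloc : LocallyIntegrable g volume := locallyIntegrable_harmonicPart h ht hQ
  have hθs : ContDiff ℝ ∞ θ := φ.contDiff_normed
  have hθc : HasCompactSupport θ := φ.hasCompactSupport_normed
  have hχs : ContDiff ℝ ∞ χ := contDiff_probeBump R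
  have hχc : HasCompactSupport χ := hasCompactSupport_probeBump hR
  have hχ1 : ContDiff ℝ 1 χ := contDiff_infty.1 hχs 1
  have hΦs : ContDiff ℝ ∞ Φ := contDiff_probeConv φ hR
  have hΦc : HasCompactSupport Φ := hasCompactSupport_probeConv φ hR
  have hΦ1 : ContDiff ℝ 1 Φ := contDiff_infty.1 hΦs 1
  have hΦ2 : ContDiff ℝ 2 Φ := contDiff_infty.1 hΦs 2
  -- Step 1: mean-value formula for the gradient of the harmonic function `θ ⋆ g`
  have hη := harmonicOnNhd_mollified_harmonicPart h hS ht hQ hQeq hθs hθc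
  rw [fderiv_harmonic_eq_integral_probeBump hη hR x₀ a]
  -- Step 2: `∫ ∂ₐχ_R(z) (θ ⋆ g)(x₀ - z) dz = ((∂ₐχ_R ⋆ θ) ⋆ g)(x₀) = ∫ ∂ₐΦ(y) g(x₀ - y) dy`
  have hχa : Continuous fun z => fderiv ℝ χ z a :=
    (hχ1.continuous_fderiv one_ne_zero).clm_apply continuous_const
  have hχac : HasCompactSupport fun z => fderiv ℝ χ z a := hχc.fderiv_apply (𝕜 := ℝ) a
  have e1 : ∫ z, fderiv ℝ χ z a * (θ ⋆ g) (x₀ - z) = ((fun z => fderiv ℝ χ z a) ⋆ (θ ⋆ g)) x₀ := by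
    rw [convolution_lsmul]
    rfl
  have e2 : ((fun z => fderiv ℝ χ z a) ⋆ (θ ⋆ g)) x₀ = (((fun z => fderiv ℝ χ z a) ⋆ θ) ⋆ g) x₀ :=
    (ConvolutionLaplacian.convolution_assoc_of_hasCompactSupport hχa hχac φ.continuous_normed hθc
      hgloc x₀).symm
  have e3 : (fun z => fderiv ℝ χ z a) ⋆ θ = fun y => fderiv ℝ Φ y a :=
    funext fun y => (fderiv_probeConv_apply φ hR y a).symm
  rw [e1, e2, e3, convolution_lsmul]
  simp only [smul_eq_mul]
  -- Step 3: split `g = p - Π`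
  have hΦa : Continuous fun y => fderiv ℝ Φ y a :=
    (hΦ1.continuous_fderiv one_ne_zero).clm_apply continuous_const
  have hΦac : HasCompactSupport fun y => fderiv ℝ Φ y a := hΦc.fderiv_apply (𝕜 := ℝ) a
  have iP : Integrable fun y => fderiv ℝ Φ y a * p t (x₀ - y) :=
    (hΦa.mul (hp.continuous.comp (continuous_const.sub continuous_id))).integrable_of_hasCompactSupport
      hΦac.mul_right
  have iQ : Integrable fun y => fderiv ℝ Φ y a * Q (x₀ - y) :=
    (hΦac.convolutionExists_left (lsmul ℝ ℝ : ℝ →L[ℝ] ℝ →L[ℝ] ℝ) hΦa hPiloc x₀).integrable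
  have e4 : ∫ y, fderiv ℝ Φ y a * g (x₀ - y) =
      (∫ y, fderiv ℝ Φ y a * p t (x₀ - y)) - ∫ y, fderiv ℝ Φ y a * Q (x₀ - y) := by
    rw [← integral_sub iP iQ]
    refine integral_congr_ae (Eventually.of_forall fun y => ?_)
    simp only [hg_def, mul_sub]
  rw [e4]
  -- Step 4: the pressure part through the momentum equation
  -- the test field `Ψ(y) = Φ(x₀ - y) a`
  set ψ : (EuclideanSpace ℝ (Fin 3)) → ℝ := fun y => Φ (x₀ - y) with hψ_def
  have hψs : ContDiff ℝ ∞ ψ := hΦs.comp (contDiff_const.sub contDiff_id)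
  have hψ2 : ContDiff ℝ 2 ψ := contDiff_infty.1 hψs 2
  have hψ1 : ContDiff ℝ 1 ψ := contDiff_infty.1 hψs 1
  have hψc : HasCompactSupport ψ := hΦc.comp_homeomorph (Homeomorph.subLeft x₀)
  set Ψ : (EuclideanSpace ℝ (Fin 3)) → (EuclideanSpace ℝ (Fin 3)) := fun y => ψ y • a with hΨ_def
  have hΨ2 : ContDiff ℝ 2 Ψ := hψ2.smul contDiff_const
  have hΨ1 : ContDiff ℝ 1 Ψ := hψ1.smul contDiff_const
  have hΨc : HasCompactSupport Ψ := hψc.smul_right (f' := fun _ => a)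
  have hΨcont : Continuous Ψ := hΨ1.continuous
  have hDΨ : ∀ y w, fderiv ℝ Ψ y w = (fderiv ℝ ψ y w) • a := fun y w => by
    simp only [hΨ_def]
    rw [fderiv_smul_const (hψ1.differentiable one_ne_zero y), ContinuousLinearMap.smulRight_apply]
  have hΔΨ : ∀ y, (Δ Ψ) y = (Δ ψ) y • a := fun y => by
    have e : Ψ = (ContinuousLinearMap.toSpanSingleton ℝ a) ∘ ψ := by
      funext w; simp [hΨ_def, ContinuousLinearMap.toSpanSingleton_apply]
    rw [e, hψ2.contDiffAt.laplacian_CLM_comp_left]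
    simp [ContinuousLinearMap.toSpanSingleton_apply]
  -- continuity of the slices entering the momentum equation
  have hΔuc : Continuous (Δ (u t)) := FluidPDE.continuous_laplacian hu2
  have hdtc : Continuous (FluidPDE.timeDerivWithin S u t) :=
    ((h.smooth_velocity.timeDerivWithin hS.uniqueDiffOn).contDiff_slice ht).continuous
  have hcvc : Continuous (FluidPDE.convect (u t) (u t)) :=
    (hu1.continuous_fderiv one_ne_zero).clm_apply huc
  -- integration by parts, then change of variables `y ↦ x₀ - y`
  have e5 : ∫ y, fderiv ℝ Φ y a * p t (x₀ - y) = ∫ y, ⟪gradient (p t) y, Ψ y⟫ := by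
    rw [integral_fderiv_mul_comp_sub hΦ1 hΦc hp1 x₀ a,
      ← integral_sub_left_eq_self (fun y => Φ y * fderiv ℝ (p t) (x₀ - y) a) volume x₀]
    refine integral_congr_ae (Eventually.of_forall fun y => ?_)
    have hgr : ⟪gradient (p t) y, a⟫ = fderiv ℝ (p t) y a := by
      rw [real_inner_comm, inner_gradient_eq_fderiv_apply]
    simp only [sub_sub_cancel, hΨ_def, hψ_def, inner_smul_right, hgr]
  have iL := FluidPDE.integrable_inner_of_hasCompactSupport_right hΔuc hΨcont hΨc
  have iT := FluidPDE.integrable_inner_of_hasCompactSupport_right hdtc hΨcont hΨc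
  have iC := FluidPDE.integrable_inner_of_hasCompactSupport_right hcvc hΨcont hΨc
  have e6 : ∫ y, ⟪gradient (p t) y, Ψ y⟫ =
      ν * (∫ y, ⟪(Δ (u t)) y, Ψ y⟫) - (∫ y, ⟪FluidPDE.timeDerivWithin S u t y, Ψ y⟫) -
        ∫ y, ⟪FluidPDE.convect (u t) (u t) y, Ψ y⟫ := by
    have key : ∀ y, ⟪gradient (p t) y, Ψ y⟫ = ν * ⟪(Δ (u t)) y, Ψ y⟫ -
        ⟪FluidPDE.timeDerivWithin S u t y, Ψ y⟫ - ⟪FluidPDE.convect (u t) (u t) y, Ψ y⟫ := by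
      intro y
      rw [PressureNormalisationL3.gradient_pressure_eq h ht y, inner_sub_left, inner_sub_left, inner_smul_left]
      simp
    have i2 : Integrable fun y => ν * ⟪(Δ (u t)) y, Ψ y⟫ := iL.const_mul ν
    have i1 : Integrable fun y => ν * ⟪(Δ (u t)) y, Ψ y⟫ -
        ⟪FluidPDE.timeDerivWithin S u t y, Ψ y⟫ := i2.sub iT
    rw [integral_congr_ae (Eventually.of_forall key), integral_sub i1 iC, integral_sub i2 iT,
      integral_const_mul]
  -- Green's identity for the viscous term
  have e7 : ∫ y, ⟪(Δ (u t)) y, Ψ y⟫ = ∫ y, ⟪u t y, (Δ ψ) y • a⟫ := by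
    rw [FluidPDE.integral_inner_laplacian_comm hu2 hΨ2 hΨc]
    exact integral_congr_ae (Eventually.of_forall fun y => by
      show ⟪u t y, (Δ Ψ) y⟫ = ⟪u t y, (Δ ψ) y • a⟫
      rw [hΔΨ y])
  -- the trilinear identity for the transport term
  have e8 : ∫ y, ⟪FluidPDE.convect (u t) (u t) y, Ψ y⟫ =
      -∫ y, ⟪u t y, fderiv ℝ ψ y (u t y) • a⟫ := by
    have h0 := FluidPDE.integral_inner_convect_add_eq_zero hu1 hu1 hΨ1 hΨc
    have hz : ∫ y, VectorCalculus.divergence (u t) y * ⟪u t y, Ψ y⟫ = 0 := by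
      simp [h.divFree t ht _]
    have hc : ∫ y, ⟪u t y, FluidPDE.convect (u t) Ψ y⟫ = ∫ y, ⟪u t y, fderiv ℝ ψ y (u t y) • a⟫ :=
      integral_congr_ae (Eventually.of_forall fun y => by simp only [FluidPDE.convect, hDΨ])
    linarith
  rw [e5, e6, e7, e8]
  ring

end PressureNormalisation

end Literature.Analysis.FluidPDE

end
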